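import Summits.CriticalPhenomena.SAWScalingLimit.Theorems.SAWLoopFugacityFlowSimpleSubseqLimitsStubRangeIsArcSandwich
import Summits.CriticalPhenomena.SAWScalingLimit.Theorems.SAWLoopFugacityFlowSimpleSubseqLimitsStubRangeIsArcTwoHull
import Summits.CriticalPhenomena.SAWScalingLimit.Theorems.SAWLoopFugacityFlowSimpleSubseqLimitsStubRangeIsArcDisjointFills
import Summits.CriticalPhenomena.SAWScalingLimit.Theorems.SAWLoopFugacityFlowSimpleSubseqLimitsStubRangeIsArcPieces
import Summits.CriticalPhenomena.SAWScalingLimit.Theorems.SAWLoopFugacityFlowSimpleSubseqLimitsStubRangeIsArcEnclose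
import Literature.Probability.RandomPlanarGeometry.ArcHullDomains
import Literature.Probability.RandomPlanarGeometry.HullApproximationProofs
import Literature.Probability.RandomPlanarGeometry.HalfPlaneFillProofs
import Literature.Probability.RandomPlanarGeometry.ConformalMapCaratheodoryProofs
import Literature.Topology.PlaneTopology.JordanCurveProofs
import HarnessLib

/-!
# Agreement on two-sided avoidance events — helper stub `stub_rangeIsArc_agree`
(line `marked-point-revisit`, crux `SAWLoopFugacityFlow.SimpleSubseqLimits`, stmt-CriticalPhenomena-4982;
plan `RangeIsArc-PLAN.md`, H8 = step (T))

Let `φ` be a chordal uniformizing map of `(D; a, b)`, `Tp, Tm ⊆ ℍ̄` compact, each empty or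
anchored (`IsAnchored`), with the real points of `Tp` positive and those of `Tm` negative, and
`ν`, `μ` finite measures carried by classes from `a` to `b` in `D ∪ {a, b}` with
`AvoidanceAgree D ν μ`. Then `ν` and `μ` give the same mass to `{range ∩ φ̄(Tp ∪ Tm) = ∅}`.

Proof. If no carrier class avoids `φ̄(Tp ∪ Tm)` both sides vanish. Otherwise the path-piece
lemma (`ArcRangePieces`) gives `0 ∉ Fill` of `Tp`, `Tm`, `Tp ∪ Tm`, so `Tp ∩ Tm = ∅`
(`ArcRangeEnclose`) and the fills `A± = hpFill T±` are disjoint `±`-hulls (`ArcRangeFills`); the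
tree's smooth outer approximations `J±ⁿ ↓ realFill A±` (`IsPlusHull.arcHull`, interiors ⊇ `A± ∩ ℍ`;
minus side by `imagAxisRefl`) are eventually disjoint and give two-hull Jordan subdomains
(`ArcRangeTwoHull`; one-hull ones by `exists_isHullSubdomain_of_isArcHull`), to which the sandwich
(`ArcRangeSandwich`) applies: (i) `range ⊆ closure D''_n` keeps the pulled-back trace off
`interior J ⊇ T ∩ ℍ`; (ii) avoidance of `T` gives avoidance of `Fill(T±)`, of `⋂ J`, of some `J n`.
-/

noncomputable section

open MeasureTheory Filter Topology Set Metric Bornology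
open Literature.Probability.RandomPlanarGeometry
open UpperHalfPlane (upperHalfPlaneSet isOpen_upperHalfPlaneSet)
open Summit.CriticalPhenomena.SAWScalingLimit.Theorems.SimpleSubseqLimits.MarkedPointRevisit.Glue
open scoped ENNReal NNReal unitInterval

namespace Summit.CriticalPhenomena.SAWScalingLimit.Theorems.SimpleSubseqLimits.MarkedPointRevisit.ArcRangeAgree

variable {D : DobrushinDomain} {φ : ConformalEquiv upperHalfPlaneSet D.carrier}
/-! ### Outer approximation of the fill of a one-sided anchored set by smooth hulls -/
/-- The lower closed half-plane with the empty set attached is connected. [folklore] -/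
theorem isConnected_empty_union : IsConnected ((∅ : Set ℂ) ∪ {z : ℂ | z.im ≤ 0}) := by
  rw [empty_union]; exact isConnected_setOf_im_nonpos

/-- **Plus side.** For a compact `T ⊆ ℍ̄` attached to the lower half-plane with positive real
points, `0 ∉ Fill(T)` and `T ∩ ℍ ≠ ∅`: decreasing smooth `+`-hulls containing `T ∩ ℍ` in their
interiors and shrinking to `Fill(T)` plus positive reals (the tree's `IsPlusHull.arcHull` of the
`+`-hull `hpFill T`). [folklore] -/
theorem exists_hulls_plus {T : Set ℂ} (hT : IsCompact T) (hTcl : T ⊆ closure upperHalfPlaneSet)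
    (hconn : IsConnected (T ∪ {z : ℂ | z.im ≤ 0})) (hsign : ∀ x : ℝ, (x : ℂ) ∈ T → 0 < x)
    (h0 : (0 : ℂ) ∉ hpFill T) (hne : (T ∩ upperHalfPlaneSet).Nonempty) :
    ∃ J : ℕ → Set ℂ, (∀ n, IsArcHull (J n)) ∧ (∀ n, IsPlusHull (J n)) ∧ Antitone J ∧
      (∀ n, T ∩ upperHalfPlaneSet ⊆ interior (J n)) ∧
      (⋂ n, J n) ⊆ hpFill T ∪ {z : ℂ | z.im = 0 ∧ 0 < z.re} := by
  have hstar : IsStarHull (hpFill T) :=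
    isStarHull_hpFill isSimplyConnected_of_isConnected_compl_holds hT.isClosed hT.isBounded hconn h0
  obtain ⟨-, hsgn, -⟩ := ArcRangeFills.stub_rangeIsArc_disjointFills T ∅ hT isCompact_empty hTcl (empty_subset _) hconn
    isConnected_empty_union hsign (fun x hx ↦ absurd hx (Set.notMem_empty _)) (disjoint_empty T)
  have hA : IsPlusHull (hpFill T) := ⟨hstar, hsgn⟩
  have hneA : (hpFill T).Nonempty := by
    obtain ⟨z, hz⟩ := hne
    exact ⟨z, inter_subset_hpFill T hz⟩
  refine ⟨hA.arcHull hneA, fun n ↦ hA.isArcHull_arcHull hneA n, fun n ↦ hA.isPlusHull_arcHull hneA n,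
    hA.antitone_arcHull hneA, fun n z hz ↦ hA.mem_interior_arcHull hneA n (inter_subset_hpFill T hz) hz.2,
    ?_⟩
  rw [hA.iInter_arcHull hneA]
  rintro z (hz | ⟨x, hx, rfl⟩)
  · exact Or.inl hz
  · right
    refine ⟨by simp, ?_⟩
    have : 0 < leftPt (hpFill T) := hA.leftPt_pos hneA
    simp only [Complex.ofReal_re]
    exact lt_of_lt_of_le this hx.1

/-- **Minus side**, by the reflection `σ(z) = -z̄` about the imaginary axis. [folklore] -/
theorem exists_hulls_minus {T : Set ℂ} (hT : IsCompact T) (hTcl : T ⊆ closure upperHalfPlaneSet)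
    (hconn : IsConnected (T ∪ {z : ℂ | z.im ≤ 0})) (hsign : ∀ x : ℝ, (x : ℂ) ∈ T → x < 0)
    (h0 : (0 : ℂ) ∉ hpFill T) (hne : (T ∩ upperHalfPlaneSet).Nonempty) :
    ∃ J : ℕ → Set ℂ, (∀ n, IsArcHull (J n)) ∧ (∀ n, IsMinusHull (J n)) ∧ Antitone J ∧
      (∀ n, T ∩ upperHalfPlaneSet ⊆ interior (J n)) ∧
      (⋂ n, J n) ⊆ hpFill T ∪ {z : ℂ | z.im = 0 ∧ z.re < 0} := by
  have hstar : IsStarHull (hpFill T) :=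
    isStarHull_hpFill isSimplyConnected_of_isConnected_compl_holds hT.isClosed hT.isBounded hconn h0
  obtain ⟨-, -, hsgn⟩ := ArcRangeFills.stub_rangeIsArc_disjointFills ∅ T isCompact_empty hT (empty_subset _) hTcl
    isConnected_empty_union hconn (fun x hx ↦ absurd hx (Set.notMem_empty _)) hsign (empty_disjoint T)
  have hA : IsMinusHull (hpFill T) := ⟨hstar, hsgn⟩
  have hA' : IsPlusHull (imagAxisRefl '' hpFill T) := hA.image_imagAxisRefl
  have hneA' : (imagAxisRefl '' hpFill T).Nonempty := by
    obtain ⟨z, hz⟩ := hne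
    exact ⟨_, ⟨z, inter_subset_hpFill T hz, rfl⟩⟩
  set J' := hA'.arcHull hneA' with hJ'
  refine ⟨fun n ↦ imagAxisRefl '' J' n, fun n ↦ (hA'.isArcHull_arcHull hneA' n).image_imagAxisRefl,
    fun n ↦ (hA'.isPlusHull_arcHull hneA' n).image_imagAxisRefl,
    fun m n hmn ↦ image_mono (hA'.antitone_arcHull hneA' hmn), fun n z hz ↦ ?_, ?_⟩
  · rw [← imagAxisRefl.image_interior]
    refine ⟨imagAxisRefl z, hA'.mem_interior_arcHull hneA' n ⟨z, inter_subset_hpFill T hz, rfl⟩ ?_,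
      imagAxisRefl_imagAxisRefl z⟩
    rw [imagAxisRefl_im]; exact hz.2
  · rw [← image_iInter imagAxisRefl.bijective, hA'.iInter_arcHull hneA']
    rintro _ ⟨w, hw | ⟨x, hx, rfl⟩, rfl⟩
    · obtain ⟨z, hz, rfl⟩ := hw
      rw [imagAxisRefl_imagAxisRefl]; exact Or.inl hz
    · right
      rw [imagAxisRefl_ofReal]
      refine ⟨by simp, ?_⟩
      have : 0 < leftPt (imagAxisRefl '' hpFill T) := hA'.leftPt_pos hneA'
      have hx1 : leftPt (imagAxisRefl '' hpFill T) ≤ x := hx.1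
      simp only [Complex.ofReal_re]
      linarith

/-- **Eventual disjointness** of two decreasing sequences of closed sets, the first terms
bounded, with disjoint intersections. [folklore] -/
theorem exists_forall_disjoint {Jp Jm : ℕ → Set ℂ} (hpc : ∀ n, IsClosed (Jp n))
    (hmc : ∀ n, IsClosed (Jm n)) (hpa : Antitone Jp) (hma : Antitone Jm) (hb : IsBounded (Jp 0))
    (hdisj : Disjoint (⋂ n, Jp n) (⋂ n, Jm n)) : ∃ N, ∀ n, N ≤ n → Disjoint (Jp n) (Jm n) := by
  set P : ℕ → Set ℂ := fun n ↦ Jp n ∩ Jm n with hP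
  have hPc : ∀ n, IsClosed (P n) := fun n ↦ (hpc n).inter (hmc n)
  have hPa : Antitone P := fun m n hmn ↦ inter_subset_inter (hpa hmn) (hma hmn)
  have hPi : (⋂ n, P n) = ∅ := by
    refine Set.eq_empty_of_forall_notMem fun z hz ↦ ?_
    rw [mem_iInter] at hz
    exact Set.disjoint_left.1 hdisj (mem_iInter.2 fun n ↦ (hz n).1) (mem_iInter.2 fun n ↦ (hz n).2)
  have hC : IsCompact (P 0) :=
    Metric.isCompact_of_isClosed_isBounded (hPc 0) (hb.subset inter_subset_left)
  obtain ⟨N, hN⟩ := eventually_atTop.1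
    (eventually_disjoint_of_iInter_eq hPc hPa hPi hC (disjoint_empty _))
  refine ⟨N, fun n hn ↦ ?_⟩
  have h1 : P n = ∅ := by
    have := hN n hn
    rw [Set.disjoint_iff_inter_eq_empty, inter_eq_right.2 (hPa (Nat.zero_le n))] at this
    exact this
  rw [Set.disjoint_iff_inter_eq_empty]; exact h1

/-! ### Agreement on the avoidance event of `φ̄(Tp ∪ Tm)` -/
section Agree
variable (hφ : D.IsChordalUniformizing φ) {Tp Tm : Set ℂ} (hTp : IsCompact Tp) (hTm : IsCompact Tm)
  (hTpcl : Tp ⊆ closure upperHalfPlaneSet) (hTmcl : Tm ⊆ closure upperHalfPlaneSet)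
  (hap : Tp = ∅ ∨ IsAnchored Tp) (ham : Tm = ∅ ∨ IsAnchored Tm)
  (hpos : ∀ x : ℝ, (x : ℂ) ∈ Tp → 0 < x) (hneg : ∀ x : ℝ, (x : ℂ) ∈ Tm → x < 0)

/-- `0 ∉ Tp ∪ Tm`. [folklore] -/
theorem zero_notMem_union (hpos : ∀ x : ℝ, (x : ℂ) ∈ Tp → 0 < x)
    (hneg : ∀ x : ℝ, (x : ℂ) ∈ Tm → x < 0) : (0 : ℂ) ∉ Tp ∪ Tm := by
  rintro (h | h)
  · exact lt_irrefl _ (hpos 0 (by simpa using h))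
  · exact lt_irrefl _ (hneg 0 (by simpa using h))

include hφ hTpcl hTmcl hpos hneg in
/-- **(i), generic**: if `(Tp ∪ Tm) ∩ ℍ ⊆ interior (J n)` then `{range ⊆ closure φ(ℍ ∖ J n)}`
implies avoidance of `φ̄(Tp ∪ Tm)` on the carrier. [folklore] -/
theorem hi_of {J : ℕ → Set ℂ} {D' : ℕ → DobrushinDomain}
    (hcar : ∀ n, (D' n).carrier = φ '' (upperHalfPlaneSet \ J n))
    (hint : ∀ n, (Tp ∪ Tm) ∩ upperHalfPlaneSet ⊆ interior (J n)) (c : CurveClass ℂ)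
    (_hs : c.source = D.pt 0) (_ht : c.target = D.pt 1)
    (hr : c.range ⊆ D.carrier ∪ {D.pt 0, D.pt 1}) (n : ℕ)
    (h : c.range ⊆ closure (D' n).carrier) :
    Disjoint c.range (φ.boundaryExtension '' (Tp ∪ Tm)) := by
  rw [hcar n] at h
  refine (MarkedDomain.disjoint_image_boundaryExtension_iff
    JordanDomain.exists_continuousOn_extension_holds hφ (union_subset hTpcl hTmcl)
    (zero_notMem_union hpos hneg) hr).2 fun w hw hwT ↦ ?_
  exact ArcRangeSandwich.symm_notMem_interior h hw (hint n ⟨hwT, φ.symm_mapsTo hw.2⟩)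

include hφ hTp hTm hTpcl hTmcl hpos hneg in
/-- **(ii), generic**: if `⋂ J n` adds to `Fill(Tp) ∪ Fill(Tm)` only real points (and misses
`0`), avoidance of `φ̄(Tp ∪ Tm)` on the carrier implies some `{range ⊆ closure φ(ℍ ∖ J n)}`
(path-piece lemma and eventual avoidance). [folklore] -/
theorem hii_of {J : ℕ → Set ℂ} {D' : ℕ → DobrushinDomain} (hD' : ∀ n, D.IsHullSubdomain (D' n))
    (hcar : ∀ n, (D' n).carrier = φ '' (upperHalfPlaneSet \ J n)) (hJc : ∀ n, IsClosed (J n))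
    (hJa : Antitone J) (hJb : IsBounded (J 0))
    (hF : (⋂ n, J n) ∩ upperHalfPlaneSet ⊆ hpFill Tp ∪ hpFill Tm) (h0F : (0 : ℂ) ∉ ⋂ n, J n)
    (c : CurveClass ℂ) (hs : c.source = D.pt 0) (ht : c.target = D.pt 1)
    (hr : c.range ⊆ D.carrier ∪ {D.pt 0, D.pt 1})
    (h : Disjoint c.range (φ.boundaryExtension '' (Tp ∪ Tm))) :
    ∃ n, c.range ⊆ closure (D' n).carrier := by
  have hT : ∀ w ∈ c.range ∩ D.carrier, φ.symm w ∉ Tp ∪ Tm :=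
    (MarkedDomain.disjoint_image_boundaryExtension_iff
      JordanDomain.exists_continuousOn_extension_holds hφ (union_subset hTpcl hTmcl)
      (zero_notMem_union hpos hneg) hr).1 h
  have h0p : (0 : ℂ) ∉ Tp := fun h ↦ zero_notMem_union hpos hneg (Or.inl h)
  have h0m : (0 : ℂ) ∉ Tm := fun h ↦ zero_notMem_union hpos hneg (Or.inr h)
  obtain ⟨-, hfp⟩ := ArcRangePieces.stub_rangeIsArc_pieces D φ Tp c hφ hTp.isClosed hTp.isBounded h0p hs ht hr
    fun w hw h' ↦ hT w hw (Or.inl h')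
  obtain ⟨-, hfm⟩ := ArcRangePieces.stub_rangeIsArc_pieces D φ Tm c hφ hTm.isClosed hTm.isBounded h0m hs ht hr
    fun w hw h' ↦ hT w hw (Or.inr h')
  obtain ⟨n, hn⟩ := ArcRangeSandwich.exists_forall_notMem hφ hr hJc hJa hJb h0F fun w hw hwF ↦ by
    rcases hF ⟨hwF, φ.symm_mapsTo hw.2⟩ with h' | h'
    · exact hfp w hw h'
    · exact hfm w hw h'
  exact ⟨n, ArcRangeSandwich.range_subset_closure_of_forall_notMem (hD' n) (hcar n) hr hn⟩

include hφ hTp hTm hTpcl hTmcl hap ham hpos hneg in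
/-- **Agreement on `{range ∩ φ̄(Tp ∪ Tm) = ∅}`** for one-sided anchored (or empty) `Tp`, `Tm`
under `AvoidanceAgree`. [folklore] -/
theorem measure_avoid_eq {ν μ : Measure (CurveClass ℂ)} [IsFiniteMeasure ν] [IsFiniteMeasure μ]
    (hν : ∀ᵐ c ∂ν, c.source = D.pt 0 ∧ c.target = D.pt 1 ∧ c.range ⊆ D.carrier ∪ {D.pt 0, D.pt 1})
    (hμ : ∀ᵐ c ∂μ, c.source = D.pt 0 ∧ c.target = D.pt 1 ∧ c.range ⊆ D.carrier ∪ {D.pt 0, D.pt 1})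
    (hA : AvoidanceAgree D ν μ) :
    ν (CurveClass.rangeSubset (φ.boundaryExtension '' (Tp ∪ Tm))ᶜ) =
      μ (CurveClass.rangeSubset (φ.boundaryExtension '' (Tp ∪ Tm))ᶜ) := by
  have hC := JordanDomain.exists_continuousOn_extension_holds
  have hJCT := Literature.Topology.PlaneTopology.JordanCurveTheorem_holds
  have h0T := zero_notMem_union hpos hneg
  have hTcl : Tp ∪ Tm ⊆ closure upperHalfPlaneSet := union_subset hTpcl hTmcl
  set M : Set (CurveClass ℂ) := CurveClass.rangeSubset (φ.boundaryExtension '' (Tp ∪ Tm))ᶜ with hM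
  -- Case A: no class of the carrier avoids the test set
  by_cases hex : ∃ c : CurveClass ℂ, (c.source = D.pt 0 ∧ c.target = D.pt 1 ∧
      c.range ⊆ D.carrier ∪ {D.pt 0, D.pt 1}) ∧ c ∈ M
  swap
  · push Not at hex
    have hzero : ∀ {ρ : Measure (CurveClass ℂ)},
        (∀ᵐ c ∂ρ, c.source = D.pt 0 ∧ c.target = D.pt 1 ∧ c.range ⊆ D.carrier ∪ {D.pt 0, D.pt 1}) →
        ρ M = 0 := fun {ρ} hρ ↦ by
      rw [← measure_empty (μ := ρ)]
      refine measure_congr ?_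
      filter_upwards [hρ] with c hc
      exact propext ⟨fun h ↦ hex c hc h, fun h ↦ absurd h (Set.notMem_empty c)⟩
    rw [hzero hν, hzero hμ]
  -- Case B: some class `c₀` avoids; then `0 ∉ Fill` of `Tp`, `Tm`, `Tp ∪ Tm`
  obtain ⟨c₀, ⟨hs₀, ht₀, hr₀⟩, hc₀⟩ := hex
  have havoid : ∀ w ∈ c₀.range ∩ D.carrier, φ.symm w ∉ Tp ∪ Tm :=
    (MarkedDomain.disjoint_image_boundaryExtension_iff hC hφ hTcl h0T hr₀).1
      (CurveClass.disjoint_range_iff.2 hc₀)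
  have h0p : (0 : ℂ) ∉ Tp := fun h ↦ h0T (Or.inl h)
  have h0m : (0 : ℂ) ∉ Tm := fun h ↦ h0T (Or.inr h)
  have hFT : (0 : ℂ) ∉ hpFill (Tp ∪ Tm) :=
    (ArcRangePieces.stub_rangeIsArc_pieces D φ (Tp ∪ Tm) c₀ hφ (hTp.union hTm).isClosed (hTp.union hTm).isBounded h0T hs₀ ht₀
      hr₀ havoid).1
  have hFp : (0 : ℂ) ∉ hpFill Tp :=
    (ArcRangePieces.stub_rangeIsArc_pieces D φ Tp c₀ hφ hTp.isClosed hTp.isBounded h0p hs₀ ht₀ hr₀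
      fun w hw h ↦ havoid w hw (Or.inl h)).1
  have hFm : (0 : ℂ) ∉ hpFill Tm :=
    (ArcRangePieces.stub_rangeIsArc_pieces D φ Tm c₀ hφ hTm.isClosed hTm.isBounded h0m hs₀ ht₀ hr₀
      fun w hw h ↦ havoid w hw (Or.inr h)).1
  -- anchoredness of the nonempty sides
  have hconn_p : (Tp ∩ upperHalfPlaneSet).Nonempty → IsConnected (Tp ∪ {z : ℂ | z.im ≤ 0}) := by
    rintro ⟨z, hz, -⟩
    rcases hap with h | h
    · rw [h] at hz; exact absurd hz (Set.notMem_empty z)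
    · exact h.2
  have hconn_m : (Tm ∩ upperHalfPlaneSet).Nonempty → IsConnected (Tm ∪ {z : ℂ | z.im ≤ 0}) := by
    rintro ⟨z, hz, -⟩
    rcases ham with h | h
    · rw [h] at hz; exact absurd hz (Set.notMem_empty z)
    · exact h.2
  -- real points of a side with empty upper part: the whole side misses `ℍ`
  have htriv : ∀ {S : Set ℂ}, ¬ (S ∩ upperHalfPlaneSet).Nonempty → S ∩ upperHalfPlaneSet = ∅ :=
    fun h ↦ Set.not_nonempty_iff_eq_empty.1 h
  by_cases sp : (Tp ∩ upperHalfPlaneSet).Nonempty <;> by_cases sm : (Tm ∩ upperHalfPlaneSet).Nonempty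
  · -- both sides: two-hull domains
    obtain ⟨Jp, harcp, hplus, hpa, hintp, hFp'⟩ :=
      exists_hulls_plus hTp hTpcl (hconn_p sp) hpos hFp sp
    obtain ⟨Jm, harcm, hminus, hma, hintm, hFm'⟩ :=
      exists_hulls_minus hTm hTmcl (hconn_m sm) hneg hFm sm
    -- `Tp ∩ Tm = ∅`, hence disjoint fills, hence eventually disjoint hulls
    have hdisjT : Disjoint Tp Tm := by
      rw [Set.disjoint_iff_inter_eq_empty]
      by_contra hne
      exact hFT (ArcRangeEnclose.stub_rangeIsArc_enclose Tp Tm hTp hTm hTpcl hTmcl (hconn_p sp) (hconn_m sm) hpos hneg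
        (Set.nonempty_iff_ne_empty.2 hne))
    obtain ⟨hdisjF, hsgnp, hsgnm⟩ :=
      ArcRangeFills.stub_rangeIsArc_disjointFills Tp Tm hTp hTm hTpcl hTmcl (hconn_p sp) (hconn_m sm) hpos hneg hdisjT
    have hdisjI : Disjoint (⋂ n, Jp n) (⋂ n, Jm n) := by
      rw [Set.disjoint_left]
      intro z hzp hzm
      rcases hFp' hzp with hz | ⟨hzim, hzre⟩ <;> rcases hFm' hzm with hz' | ⟨hzim', hzre'⟩
      · exact Set.disjoint_left.1 hdisjF hz hz'
      · have hzeq : z = ((z.re : ℝ) : ℂ) := Complex.ext (by simp) (by simp [hzim'])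
        have := hsgnp z.re (hzeq ▸ hz); linarith
      · have hzeq : z = ((z.re : ℝ) : ℂ) := Complex.ext (by simp) (by simp [hzim])
        have := hsgnm z.re (hzeq ▸ hz'); linarith
      · linarith
    obtain ⟨N, hN⟩ := exists_forall_disjoint (fun n ↦ (harcp n).isBoundedHull.isClosed)
      (fun n ↦ (harcm n).isBoundedHull.isClosed) hpa hma (harcp 0).isBoundedHull.1 hdisjI
    set J : ℕ → Set ℂ := fun n ↦ Jp (n + N) ∪ Jm (n + N) with hJ
    have hD'ex : ∀ n, ∃ D' : DobrushinDomain, D.IsHullSubdomain D' ∧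
        D'.carrier = φ '' (upperHalfPlaneSet \ J n) := fun n ↦
      ArcRangeTwoHull.stub_rangeIsArc_twoHull D φ (Jp (n + N)) (Jm (n + N)) hφ (harcp _) (hplus _) (harcm _) (hminus _)
        (hN _ (Nat.le_add_left N n))
    choose D' hD' hcar using hD'ex
    have hJa : Antitone J := fun m n hmn ↦
      union_subset_union (hpa (Nat.add_le_add_right hmn N)) (hma (Nat.add_le_add_right hmn N))
    refine ArcRangeSandwich.measure_eq_of_sandwich hν hμ hA J D' hD' hcar hJa
      (hi_of hφ hTpcl hTmcl hpos hneg hcar fun n ↦ ?_)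
      (hii_of hφ hTp hTm hTpcl hTmcl hpos hneg hD' hcar
        (fun n ↦ ((harcp _).isBoundedHull.isClosed).union (harcm _).isBoundedHull.isClosed) hJa
        (((harcp _).isBoundedHull.1).union (harcm _).isBoundedHull.1) ?_ ?_)
    · rintro z ⟨hzT | hzT, hzH⟩
      · exact interior_mono subset_union_left (hintp _ ⟨hzT, hzH⟩)
      · exact interior_mono subset_union_right (hintm _ ⟨hzT, hzH⟩)
    · -- `⋂ J ⊆ ⋂ Jp ∪ ⋂ Jm`
      rintro z ⟨hz, hzH⟩
      rw [mem_iInter] at hz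
      by_cases hzp : z ∈ ⋂ n, Jp n
      · rcases hFp' hzp with h | ⟨h, -⟩
        · exact Or.inl h
        · exact absurd hzH (by simp [upperHalfPlaneSet, h])
      by_cases hzm : z ∈ ⋂ n, Jm n
      · rcases hFm' hzm with h | ⟨h, -⟩
        · exact Or.inr h
        · exact absurd hzH (by simp [upperHalfPlaneSet, h])
      exfalso
      rw [mem_iInter, not_forall] at hzp hzm
      obtain ⟨n₁, hn₁⟩ := hzp
      obtain ⟨n₂, hn₂⟩ := hzm
      rcases hz (max n₁ n₂) with h | h
      · exact hn₁ (hpa (le_trans (le_max_left _ _) (Nat.le_add_right _ _)) h)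
      · exact hn₂ (hma (le_trans (le_max_right _ _) (Nat.le_add_right _ _)) h)
    · intro h0
      rw [mem_iInter] at h0
      rcases h0 0 with h | h
      · exact (hplus _).1.2 h
      · exact (hminus _).1.2 h
  · -- plus side only: one-hull domains
    obtain ⟨Jp, harcp, hplus, hpa, hintp, hFp'⟩ :=
      exists_hulls_plus hTp hTpcl (hconn_p sp) hpos hFp sp
    have hD'ex : ∀ n, ∃ D' : DobrushinDomain, D.IsHullSubdomain D' ∧
        D'.carrier = φ '' (upperHalfPlaneSet \ Jp n) := fun n ↦
      exists_isHullSubdomain_of_isArcHull hJCT hC hφ (harcp n) (hplus n).1.2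
    choose D' hD' hcar using hD'ex
    refine ArcRangeSandwich.measure_eq_of_sandwich hν hμ hA Jp D' hD' hcar hpa
      (hi_of hφ hTpcl hTmcl hpos hneg hcar fun n ↦ ?_)
      (hii_of hφ hTp hTm hTpcl hTmcl hpos hneg hD' hcar
        (fun n ↦ (harcp n).isBoundedHull.isClosed) hpa (harcp 0).isBoundedHull.1 ?_ ?_)
    · rintro z ⟨hzT | hzT, hzH⟩
      · exact hintp n ⟨hzT, hzH⟩
      · exfalso
        have : z ∈ Tm ∩ upperHalfPlaneSet := ⟨hzT, hzH⟩
        rw [htriv sm] at this; exact this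
    · rintro z ⟨hz, hzH⟩
      rcases hFp' hz with h | ⟨h, -⟩
      · exact Or.inl h
      · exact absurd hzH (by simp [upperHalfPlaneSet, h])
    · intro h0
      exact (hplus 0).1.2 (mem_iInter.1 h0 0)
  · -- minus side only
    obtain ⟨Jm, harcm, hminus, hma, hintm, hFm'⟩ :=
      exists_hulls_minus hTm hTmcl (hconn_m sm) hneg hFm sm
    have hD'ex : ∀ n, ∃ D' : DobrushinDomain, D.IsHullSubdomain D' ∧
        D'.carrier = φ '' (upperHalfPlaneSet \ Jm n) := fun n ↦
      exists_isHullSubdomain_of_isArcHull hJCT hC hφ (harcm n) (hminus n).1.2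
    choose D' hD' hcar using hD'ex
    refine ArcRangeSandwich.measure_eq_of_sandwich hν hμ hA Jm D' hD' hcar hma
      (hi_of hφ hTpcl hTmcl hpos hneg hcar fun n ↦ ?_)
      (hii_of hφ hTp hTm hTpcl hTmcl hpos hneg hD' hcar
        (fun n ↦ (harcm n).isBoundedHull.isClosed) hma (harcm 0).isBoundedHull.1 ?_ ?_)
    · rintro z ⟨hzT | hzT, hzH⟩
      · exfalso
        have : z ∈ Tp ∩ upperHalfPlaneSet := ⟨hzT, hzH⟩
        rw [htriv sp] at this; exact this
      · exact hintm n ⟨hzT, hzH⟩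
    · rintro z ⟨hz, hzH⟩
      rcases hFm' hz with h | ⟨h, -⟩
      · exact Or.inr h
      · exact absurd hzH (by simp [upperHalfPlaneSet, h])
    · intro h0
      exact (hminus 0).1.2 (mem_iInter.1 h0 0)
  · -- no side meets `ℍ`: the whole domain
    refine ArcRangeSandwich.measure_eq_of_sandwich hν hμ hA (fun _ ↦ ∅) (fun _ ↦ D)
      (fun _ ↦ MarkedDomain.isHullSubdomain_self D) (fun _ ↦ ?_) (fun _ _ _ ↦ le_rfl)
      (hi_of hφ hTpcl hTmcl hpos hneg (D' := fun _ ↦ D) (J := fun _ ↦ ∅) (fun _ ↦ ?_)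
        fun n ↦ ?_)
      (fun c _ _ hr _ ↦ ⟨0, ArcRangeSandwich.range_subset_closure_self hr⟩)
    all_goals first
      | (rw [sdiff_empty]; exact φ.bijOn.image_eq.symm)
      | skip
    rintro z ⟨hzT | hzT, hzH⟩
    · have : z ∈ Tp ∩ upperHalfPlaneSet := ⟨hzT, hzH⟩
      rw [htriv sp] at this; exact absurd this (Set.notMem_empty z)
    · have : z ∈ Tm ∩ upperHalfPlaneSet := ⟨hzT, hzH⟩
      rw [htriv sm] at this; exact absurd this (Set.notMem_empty z)

end Agree

/-- **Registered form of the agreement lemma** (`measure_avoid_eq` with all binders explicit).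
[folklore] -/
theorem stub_rangeIsArc_agree :
    ∀ (D : DobrushinDomain) (φ : ConformalEquiv upperHalfPlaneSet D.carrier) (Tp Tm : Set ℂ)
      (ν μ : Measure (CurveClass ℂ)), D.IsChordalUniformizing φ → IsCompact Tp → IsCompact Tm →
      Tp ⊆ closure upperHalfPlaneSet → Tm ⊆ closure upperHalfPlaneSet →
      (Tp = ∅ ∨ IsAnchored Tp) → (Tm = ∅ ∨ IsAnchored Tm) →
      (∀ x : ℝ, (x : ℂ) ∈ Tp → 0 < x) → (∀ x : ℝ, (x : ℂ) ∈ Tm → x < 0) →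
      IsFiniteMeasure ν → IsFiniteMeasure μ →
      (∀ᵐ c ∂ν, c.source = D.pt 0 ∧ c.target = D.pt 1 ∧ c.range ⊆ D.carrier ∪ {D.pt 0, D.pt 1}) →
      (∀ᵐ c ∂μ, c.source = D.pt 0 ∧ c.target = D.pt 1 ∧ c.range ⊆ D.carrier ∪ {D.pt 0, D.pt 1}) →
      AvoidanceAgree D ν μ →
      ν (CurveClass.rangeSubset (φ.boundaryExtension '' (Tp ∪ Tm))ᶜ) =
        μ (CurveClass.rangeSubset (φ.boundaryExtension '' (Tp ∪ Tm))ᶜ) := by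
  intro D φ Tp Tm ν μ hφ hTp hTm hTpcl hTmcl hap ham hpos hneg _ _ hν hμ hA
  exact measure_avoid_eq hφ hTp hTm hTpcl hTmcl hap ham hpos hneg hν hμ hA

end Summit.CriticalPhenomena.SAWScalingLimit.Theorems.SimpleSubseqLimits.MarkedPointRevisit.ArcRangeAgree

end
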